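import Mathlib
import Literature.Probability.Percolation.PercolationProofs
import Literature.Probability.LatticeModels.ProdBernoulliIndependence
import Literature.Probability.LatticeModels.ProdBernoulliClusterLocality
import Summits.CriticalPhenomena.PercolationContinuityZ3.Theorems.PercNearOneGluingAdditiveGluingSigmaRecursion
import Summits.CriticalPhenomena.PercolationContinuityZ3.Theorems.PercNearOneGluingAdditiveGluingSigmaLaw
import Summits.CriticalPhenomena.PercolationContinuityZ3.Theorems.PercNearOneGluingAdditiveGluingSigmaGeometry
import Summits.CriticalPhenomena.PercolationContinuityZ3.Theorems.PercNearOneGluingAdditiveGluingGluingLemma5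
import Summits.CriticalPhenomena.PercolationContinuityZ3.Theorems.PercNearOneGluingAdditiveGluingLemma5AnyRelay
import Summits.CriticalPhenomena.PercolationContinuityZ3.Theorems.PercNearOneGluingAdditiveGluingGoodBase
import HarnessLib

/-! # Crux `PercNearOneGluing.AdditiveGluing` (stmt-CriticalPhenomena-4576), line `subuniform-dead-pocket-maximum` — corner reduction of `stub_goodStep`, TOOLKIT (siege k4)

Helper file for the crux (skeleton `Cruxes/AdditiveGluing/Lines/subuniform-dead-pocket-maximum.lean`,
stub `stub_goodStep`); lands with `--supports stmt-CriticalPhenomena-4576`.  Toolkit for the corner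
reduction `goodStep_corner` (file `…GoodStepCorner.lean`): weight bookkeeping for the observer block
`{o}` (gluing `{o}` or a block of ≤ 1 vertex changes nothing; the killed weighting `w⁰` = weight 0
on every pair meeting `o`), the dead-pocket partition `Σ_{W ∋ x, W∩A=∅} μ(C(x)=W) = μ(x ↮ A)` and the
identity "linear selection form = KN form" of Kozma–Nitzan goodness (arXiv:2401.12397 §3.2 p. 12),
and the three LAYER FACTORISATIONS at a single observer (from the landed `stub_sigmaLaw` and
`stub_sigmaGeometry`, `O = {o}`): for the layer event `L_S` (open star of `o` = `S`) and the glued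
off-block weighting `q_S` (`w⁰` with weight 1 on the non-loop pairs inside `S`),
`μ_w(L_S ∩ {u ↔ v}) = μ_w(L_S)·μ_{q_S}(u ↔ v)` (`u, v ≠ o`), `μ_w(L_S ∩ {o ↔ b}) = μ_w(L_S)·μ_{q_S}(S ↔ b)`,
`μ_w(L_S ∩ {C(o) = W}) = μ_w(L_S)·μ_{q_S}(E_S W)` with
`E_S(W) = {ω' | ∀ y, y ∈ W ↔ (y = o ∨ ∃ s ∈ S, s ↔ y in ω')}`.  No new definitions (weightings inline).
-/

namespace Summit.CriticalPhenomena.PercolationContinuityZ3.Theorems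

open MeasureTheory Set
open Literature.Probability.LatticeModels (prodBernoulli)
open Literature.Probability.Percolation (BondConfig openConn openConnIn openGraph openCluster
  openGraph_adj DeterminedBy determinedBy_iff)
open scoped BigOperators

noncomputable section
open Classical

variable {n : ℕ}

/-! ### Weight bookkeeping for the observer block `{o}` -/

/-- Gluing the singleton block `{o}` changes no weight (the only pair inside `{o}` is a loop).
[folklore] -/
theorem goodStepCorner_glue_singleton (w : Sym2 (Fin n) → unitInterval) (o : Fin n) :
    (fun e : Sym2 (Fin n) =>
        if (∀ x ∈ e, x ∈ ({o} : Finset (Fin n))) ∧ ¬ e.IsDiag then (1 : unitInterval) else w e) =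
      w := by
  funext e
  induction e using Sym2.ind with
  | h x y =>
    refine if_neg ?_
    rintro ⟨h1, h2⟩
    have hx : x = o := Finset.mem_singleton.1 (h1 x (Sym2.mem_mk_left x y))
    have hy : y = o := Finset.mem_singleton.1 (h1 y (Sym2.mem_mk_right x y))
    exact h2 (Sym2.mk_isDiag_iff.2 (hx.trans hy.symm))

/-- Gluing a block with at most one vertex changes no weight: `q_S = w⁰` when `S.card ≤ 1`.
[folklore] -/
theorem goodStepCorner_glue_subsingleton (p : Sym2 (Fin n) → unitInterval) (S : Finset (Fin n))
    (hS : S.card ≤ 1) :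
    (fun e : Sym2 (Fin n) => if (∀ x ∈ e, x ∈ S) ∧ ¬ e.IsDiag then (1 : unitInterval) else p e) =
      p := by
  funext e
  induction e using Sym2.ind with
  | h x y =>
    refine if_neg ?_
    rintro ⟨h1, h2⟩
    have hxy : x = y := Finset.card_le_one.1 hS x (h1 x (Sym2.mem_mk_left x y)) y
      (h1 y (Sym2.mem_mk_right x y))
    exact h2 (Sym2.mk_isDiag_iff.2 hxy)

/-- Off the observer the killed weights are the original ones. [folklore] -/
theorem goodStepCorner_kill_of_notMem (w : Sym2 (Fin n) → unitInterval) (o : Fin n) (e : Sym2 (Fin n))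
    (he : o ∉ e) :
    (if (∃ x ∈ e, x ∈ ({o} : Finset (Fin n))) then (0 : unitInterval) else w e) = w e := by
  rw [if_neg]
  rintro ⟨x, hx, hxo⟩
  rw [Finset.mem_singleton] at hxo
  exact he (hxo ▸ hx)

/-- At the observer the killed weights vanish. [folklore] -/
theorem goodStepCorner_kill_star (w : Sym2 (Fin n) → unitInterval) (o y : Fin n) :
    (if (∃ x ∈ s(o, y), x ∈ ({o} : Finset (Fin n))) then (0 : unitInterval) else w s(o, y)) = 0 := by
  rw [if_pos ⟨o, Sym2.mem_mk_left o y, Finset.mem_singleton_self o⟩]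

/-- Under the killed weights no non-loop pair at `o` is open: an event all of whose members
have such an open pair is null. [folklore] -/
theorem goodStepCorner_kill_null (w : Sym2 (Fin n) → unitInterval) (o : Fin n)
    (L : Set (BondConfig (Fin n))) (hL : ∀ ω ∈ L, ∃ y : Fin n, y ≠ o ∧ s(o, y) ∈ ω) :
    (prodBernoulli (fun e : Sym2 (Fin n) =>
        if (∃ x ∈ e, x ∈ ({o} : Finset (Fin n))) then (0 : unitInterval) else w e)).real L = 0 := by
  refine sigmaRec_null _ L (Finset.univ.image fun y : Fin n => s(o, y)) ?_ ?_
  · intro e he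
    obtain ⟨y, -, rfl⟩ := Finset.mem_image.1 he
    exact goodStepCorner_kill_star w o y
  · intro ω hω
    obtain ⟨y, -, hy⟩ := hL ω hω
    exact ⟨s(o, y), Finset.mem_image.2 ⟨y, Finset.mem_univ _, rfl⟩, hy⟩

/-- **Killing the star of `o` is deleting `o`**: `μ_{w⁰}(x ↔ b) = μ_w(x ↔ b in {o}ᶜ)` for
`x ≠ o`. [folklore] -/
theorem goodStepCorner_kill_real_openConn (w : Sym2 (Fin n) → unitInterval) (o x b : Fin n)
    (hx : x ≠ o) :
    (prodBernoulli (fun e : Sym2 (Fin n) =>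
        if (∃ x ∈ e, x ∈ ({o} : Finset (Fin n))) then (0 : unitInterval) else w e)).real
        (openConn x b) =
      (prodBernoulli w).real (openConnIn (({o} : Set (Fin n))ᶜ) x b) := by
  refine (lemma5AnyRelay_real_openConnIn_compl_eq w _ o x b hx (fun e he => ?_)
    (fun y _ => goodStepCorner_kill_star w o y)).symm
  refine (goodStepCorner_kill_of_notMem w o e fun hoe => ?_).symm
  exact (Set.mem_sym2_iff_subset.1 he hoe) rfl

/-! ### The dead pockets of an observer partition `{observer ↮ A}` -/

/-- **The dead pockets partition `{x ↮ A}`**: for `x ∉ A`,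
`Σ_{W ∋ x, W ∩ A = ∅} μ(C(x) = W) = μ((⋃_{a ∈ A} {x ↔ a})ᶜ)`, for any weights. [folklore] -/
theorem goodStepCorner_pocket_sum (p : Sym2 (Fin n) → unitInterval) (A : Finset (Fin n)) (x : Fin n) :
    ∑ W ∈ (Finset.univ : Finset (Finset (Fin n))).filter (fun W => x ∈ W ∧ Disjoint W A),
        (prodBernoulli p).real {ω : BondConfig (Fin n) | openCluster ω x = (W : Set (Fin n))} =
      (prodBernoulli p).real (⋃ a ∈ A, (openConn x a : Set (BondConfig (Fin n))))ᶜ := by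
  set f : BondConfig (Fin n) → Finset (Fin n) :=
    fun ω => Finset.univ.filter fun y : Fin n => y ∈ openCluster ω x with hf
  have hfib : ∀ W : Finset (Fin n),
      {ω : BondConfig (Fin n) | openCluster ω x = (W : Set (Fin n))} = f ⁻¹' {W} := by
    intro W
    ext ω
    simp only [Set.mem_setOf_eq, Set.mem_preimage, Set.mem_singleton_iff, hf]
    constructor
    · intro h
      ext y
      simp only [Finset.mem_filter, Finset.mem_univ, true_and]
      rw [h, Finset.mem_coe]
    · intro h
      ext y
      have := Finset.ext_iff.1 h y
      simp only [Finset.mem_filter, Finset.mem_univ, true_and] at this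
      rw [Finset.mem_coe]
      exact this
  have h1 : ∀ W ∈ (Finset.univ : Finset (Finset (Fin n))).filter (fun W => x ∈ W ∧ Disjoint W A),
      MeasurableSet (f ⁻¹' {W}) := fun W _ => (Set.toFinite _).measurableSet
  rw [Finset.sum_congr rfl fun W _ => by rw [hfib W],
    sum_measureReal_preimage_singleton _ h1]
  congr 1
  ext ω
  rw [Set.mem_preimage, Finset.mem_coe, Finset.mem_filter, Set.mem_compl_iff]
  constructor
  · rintro ⟨-, -, hdisj⟩ hU
    obtain ⟨a, ha, hxa⟩ := Set.mem_iUnion₂.1 hU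
    have haf : a ∈ f ω := by
      rw [hf, Finset.mem_filter]
      exact ⟨Finset.mem_univ a, hxa⟩
    exact Finset.disjoint_left.1 hdisj haf ha
  · intro h
    refine ⟨Finset.mem_univ _, ?_, Finset.disjoint_left.2 fun a haf haA => h ?_⟩
    · rw [hf, Finset.mem_filter]
      exact ⟨Finset.mem_univ x, Literature.Probability.Percolation.mem_openCluster_self ω x⟩
    · rw [hf, Finset.mem_filter] at haf
      exact Set.mem_iUnion₂.2 ⟨a, haA, haf.2⟩

/-- **Linear selection form = KN form.**  For `x ∉ A ∋ b` and any reals `c W`,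
`μ(x ↔ A, x ↮ b) + Σ_W μ(C(x)=W)(1 − c W) = 1 − μ(x ↔ b) − Σ_W μ(C(x)=W)·c W`
(sums over the dead pockets `W ∋ x`, `W ∩ A = ∅`). [folklore] -/
theorem goodStepCorner_selection_identity (p : Sym2 (Fin n) → unitInterval) (A : Finset (Fin n))
    (x b : Fin n) (hb : b ∈ A) (c : Finset (Fin n) → ℝ) :
    (prodBernoulli p).real ((⋃ a ∈ A, openConn x a) ∩ (openConn x b)ᶜ) +
        ∑ W ∈ (Finset.univ : Finset (Finset (Fin n))).filter (fun W => x ∈ W ∧ Disjoint W A),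
          (prodBernoulli p).real {ω : BondConfig (Fin n) | openCluster ω x = (W : Set (Fin n))} *
            (1 - c W) =
      1 - (prodBernoulli p).real (openConn x b) -
        ∑ W ∈ (Finset.univ : Finset (Finset (Fin n))).filter (fun W => x ∈ W ∧ Disjoint W A),
          (prodBernoulli p).real {ω : BondConfig (Fin n) | openCluster ω x = (W : Set (Fin n))} *
            c W := by
  have hsub : (openConn x b : Set (BondConfig (Fin n))) ⊆ ⋃ a ∈ A, openConn x a := fun ω hω =>
    Set.mem_iUnion₂.2 ⟨b, hb, hω⟩
  have hlive : (prodBernoulli p).real ((⋃ a ∈ A, openConn x a) ∩ (openConn x b)ᶜ) =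
      (prodBernoulli p).real (⋃ a ∈ A, (openConn x a : Set (BondConfig (Fin n)))) -
        (prodBernoulli p).real (openConn x b) := by
    rw [← Set.sdiff_eq, measureReal_sdiff hsub (Set.toFinite _).measurableSet (measure_ne_top _ _)]
  have hU : (prodBernoulli p).real (⋃ a ∈ A, (openConn x a : Set (BondConfig (Fin n))))ᶜ =
      1 - (prodBernoulli p).real (⋃ a ∈ A, (openConn x a : Set (BondConfig (Fin n)))) :=
    probReal_compl_eq_one_sub (Set.toFinite _).measurableSet
  have hsum := goodStepCorner_pocket_sum p A x
  rw [hU] at hsum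
  have hsplit : ∑ W ∈ (Finset.univ : Finset (Finset (Fin n))).filter (fun W => x ∈ W ∧ Disjoint W A),
      (prodBernoulli p).real {ω : BondConfig (Fin n) | openCluster ω x = (W : Set (Fin n))} *
        (1 - c W) =
      ∑ W ∈ (Finset.univ : Finset (Finset (Fin n))).filter (fun W => x ∈ W ∧ Disjoint W A),
        (prodBernoulli p).real {ω : BondConfig (Fin n) | openCluster ω x = (W : Set (Fin n))} -
      ∑ W ∈ (Finset.univ : Finset (Finset (Fin n))).filter (fun W => x ∈ W ∧ Disjoint W A),
        (prodBernoulli p).real {ω : BondConfig (Fin n) | openCluster ω x = (W : Set (Fin n))} *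
          c W := by
    rw [← Finset.sum_sub_distrib]
    exact Finset.sum_congr rfl fun W _ => by ring
  rw [hsplit, hsum, hlive]
  ring

/-! ### Layer factorisations for the observer block `{o}` -/

/-- The clique event of the singleton block `{o}` is trivial. [folklore] -/
theorem goodStepCorner_clique_singleton (o : Fin n) (ω : BondConfig (Fin n)) :
    ∀ o' ∈ ({o} : Finset (Fin n)), ∀ o'' ∈ ({o} : Finset (Fin n)), o' ≠ o'' → s(o', o'') ∈ ω := by
  intro o' ho' o'' ho'' hne
  rw [Finset.mem_singleton] at ho' ho''
  exact absurd (ho'.trans ho''.symm) hne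

/-- **Law of the layer decomposition at a single observer** (`stub_sigmaLaw` with `O = {o}`,
where gluing `{o}` changes no weight): `μ_w(L_S ∩ Ψ_S⁻¹ E) = μ_w(L_S) · μ_{q_S}(E)`.
[folklore; Grimmett 1999 §1.3, §2.2] -/
theorem goodStepCorner_law (w : Sym2 (Fin n) → unitInterval) (o : Fin n) (S : Finset (Fin n))
    (E : Set (BondConfig (Fin n))) :
    (prodBernoulli w).real
        ({ω : BondConfig (Fin n) | ∀ x : Fin n, x ∈ S ↔
            (x ∉ ({o} : Finset (Fin n)) ∧ ∃ o' ∈ ({o} : Finset (Fin n)), s(o', x) ∈ ω)} ∩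
          {ω | ({e | e ∈ ω ∧ ∀ x ∈ e, x ∉ ({o} : Finset (Fin n))} ∪
              {e | (∀ x ∈ e, x ∈ S) ∧ ¬ e.IsDiag} : BondConfig (Fin n)) ∈ E}) =
      (prodBernoulli w).real
          {ω : BondConfig (Fin n) | ∀ x : Fin n, x ∈ S ↔
            (x ∉ ({o} : Finset (Fin n)) ∧ ∃ o' ∈ ({o} : Finset (Fin n)), s(o', x) ∈ ω)} *
        (prodBernoulli (fun e : Sym2 (Fin n) =>
          if (∀ x ∈ e, x ∈ S) ∧ ¬ e.IsDiag then (1 : unitInterval) else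
            if (∃ x ∈ e, x ∈ ({o} : Finset (Fin n))) then 0 else w e)).real E := by
  have h := stub_sigmaLaw n w ({o} : Finset (Fin n)) S E
  rw [goodStepCorner_glue_singleton w o] at h
  exact h

/-- Factorisation of a connection event between two vertices other than `o` along the layers.
[folklore] -/
theorem goodStepCorner_fac_conn (w : Sym2 (Fin n) → unitInterval) (o u v : Fin n) (S : Finset (Fin n))
    (hu : u ≠ o) (hv : v ≠ o) :
    (prodBernoulli w).real
        ({ω : BondConfig (Fin n) | ∀ x : Fin n, x ∈ S ↔
            (x ∉ ({o} : Finset (Fin n)) ∧ ∃ o' ∈ ({o} : Finset (Fin n)), s(o', x) ∈ ω)} ∩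
          openConn u v) =
      (prodBernoulli w).real
          {ω : BondConfig (Fin n) | ∀ x : Fin n, x ∈ S ↔
            (x ∉ ({o} : Finset (Fin n)) ∧ ∃ o' ∈ ({o} : Finset (Fin n)), s(o', x) ∈ ω)} *
        (prodBernoulli (fun e : Sym2 (Fin n) =>
          if (∀ x ∈ e, x ∈ S) ∧ ¬ e.IsDiag then (1 : unitInterval) else
            if (∃ x ∈ e, x ∈ ({o} : Finset (Fin n))) then 0 else w e)).real (openConn u v) := by
  rw [← goodStepCorner_law w o S (openConn u v)]
  congr 1
  ext ω
  refine and_congr_right fun hL => ?_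
  exact ((stub_sigmaGeometry n ({o} : Finset (Fin n)) S ω hL (goodStepCorner_clique_singleton o ω)).2
    u v (fun h => hu (Finset.mem_singleton.1 h)) (fun h => hv (Finset.mem_singleton.1 h)))

/-- Factorisation of `{o ↔ b}` along the layers: on the layer `S`, `o ↔ b` iff `S ↔ b` in the
glued off-block configuration. [folklore] -/
theorem goodStepCorner_fac_obs (w : Sym2 (Fin n) → unitInterval) (o b : Fin n) (S : Finset (Fin n))
    (hb : b ≠ o) :
    (prodBernoulli w).real
        ({ω : BondConfig (Fin n) | ∀ x : Fin n, x ∈ S ↔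
            (x ∉ ({o} : Finset (Fin n)) ∧ ∃ o' ∈ ({o} : Finset (Fin n)), s(o', x) ∈ ω)} ∩
          openConn o b) =
      (prodBernoulli w).real
          {ω : BondConfig (Fin n) | ∀ x : Fin n, x ∈ S ↔
            (x ∉ ({o} : Finset (Fin n)) ∧ ∃ o' ∈ ({o} : Finset (Fin n)), s(o', x) ∈ ω)} *
        (prodBernoulli (fun e : Sym2 (Fin n) =>
          if (∀ x ∈ e, x ∈ S) ∧ ¬ e.IsDiag then (1 : unitInterval) else
            if (∃ x ∈ e, x ∈ ({o} : Finset (Fin n))) then 0 else w e)).real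
          (⋃ s ∈ S, openConn s b) := by
  rw [← goodStepCorner_law w o S (⋃ s ∈ S, openConn s b)]
  congr 1
  ext ω
  refine and_congr_right fun hL => ?_
  have h := (stub_sigmaGeometry n ({o} : Finset (Fin n)) S ω hL (goodStepCorner_clique_singleton o ω)).1
    {b} (Finset.disjoint_singleton_right.2 fun h => hb (Finset.mem_singleton.1 h))
  simp only [Finset.set_biUnion_singleton] at h
  exact h

/-- Factorisation of the pocket events `{C(o) = W}` along the layers: on the layer `S`,
`C(o) = W` iff `E_S(W)` holds for the glued off-block configuration. [folklore] -/
theorem goodStepCorner_fac_pocket (w : Sym2 (Fin n) → unitInterval) (o : Fin n) (S W : Finset (Fin n)) :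
    (prodBernoulli w).real
        ({ω : BondConfig (Fin n) | ∀ x : Fin n, x ∈ S ↔
            (x ∉ ({o} : Finset (Fin n)) ∧ ∃ o' ∈ ({o} : Finset (Fin n)), s(o', x) ∈ ω)} ∩
          {ω | openCluster ω o = (W : Set (Fin n))}) =
      (prodBernoulli w).real
          {ω : BondConfig (Fin n) | ∀ x : Fin n, x ∈ S ↔
            (x ∉ ({o} : Finset (Fin n)) ∧ ∃ o' ∈ ({o} : Finset (Fin n)), s(o', x) ∈ ω)} *
        (prodBernoulli (fun e : Sym2 (Fin n) =>
          if (∀ x ∈ e, x ∈ S) ∧ ¬ e.IsDiag then (1 : unitInterval) else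
            if (∃ x ∈ e, x ∈ ({o} : Finset (Fin n))) then 0 else w e)).real
          {ω' : BondConfig (Fin n) | ∀ y : Fin n, y ∈ W ↔ (y = o ∨ ∃ s ∈ S, ω' ∈ openConn s y)} := by
  rw [← goodStepCorner_law w o S
    {ω' : BondConfig (Fin n) | ∀ y : Fin n, y ∈ W ↔ (y = o ∨ ∃ s ∈ S, ω' ∈ openConn s y)}]
  congr 1
  ext ω
  refine and_congr_right fun hL => ?_
  have hg := stub_sigmaGeometry n ({o} : Finset (Fin n)) S ω hL (goodStepCorner_clique_singleton o ω)
  have key : ∀ y : Fin n, y ∈ openCluster ω o ↔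
      (y = o ∨ ∃ s ∈ S, ({e | e ∈ ω ∧ ∀ x ∈ e, x ∉ ({o} : Finset (Fin n))} ∪
        {e | (∀ x ∈ e, x ∈ S) ∧ ¬ e.IsDiag} : BondConfig (Fin n)) ∈ openConn s y) := by
    intro y
    by_cases hy : y = o
    · subst hy
      simp only [true_or, iff_true]
      exact Literature.Probability.Percolation.mem_openCluster_self ω y
    · have h1 := hg.1 {y} (Finset.disjoint_singleton_right.2 fun h => hy (Finset.mem_singleton.1 h))
      simp only [Finset.set_biUnion_singleton, Set.mem_iUnion, exists_prop] at h1
      rw [or_iff_right hy]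
      exact h1
  change openCluster ω o = (W : Set (Fin n)) ↔ ∀ y : Fin n, y ∈ W ↔ _
  constructor
  · intro hC y
    rw [← key y, hC, Finset.mem_coe]
  · intro h
    ext y
    rw [key y, Finset.mem_coe]
    exact (h y).symm


/-- Registered helper stub `stub_goodStepLayerPocket_k4` (siege k4, for `stub_goodStep`): **the pocket
events factor along the layers of the observer** — `μ_w(L_S ∩ {C(o) = W}) = μ_w(L_S) · μ_{q_S}(E_S W)`
(`goodStepCorner_fac_pocket` in closed form). [folklore; Grimmett 1999 §1.3, §2.2] -/
theorem stub_goodStepLayerPocket_k4 :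
    ∀ (n : ℕ) (w : Sym2 (Fin n) → unitInterval) (o : Fin n) (S W : Finset (Fin n)),
      (prodBernoulli w).real
          ({ω : BondConfig (Fin n) | ∀ x : Fin n, x ∈ S ↔
              (x ∉ ({o} : Finset (Fin n)) ∧ ∃ o' ∈ ({o} : Finset (Fin n)), s(o', x) ∈ ω)} ∩
            {ω | openCluster ω o = (W : Set (Fin n))}) =
        (prodBernoulli w).real
            {ω : BondConfig (Fin n) | ∀ x : Fin n, x ∈ S ↔
              (x ∉ ({o} : Finset (Fin n)) ∧ ∃ o' ∈ ({o} : Finset (Fin n)), s(o', x) ∈ ω)} *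
          (prodBernoulli (fun e : Sym2 (Fin n) =>
            if (∀ x ∈ e, x ∈ S) ∧ ¬ e.IsDiag then (1 : unitInterval) else
              if (∃ x ∈ e, x ∈ ({o} : Finset (Fin n))) then 0 else w e)).real
            {ω' : BondConfig (Fin n) | ∀ y : Fin n, y ∈ W ↔ (y = o ∨ ∃ s ∈ S, ω' ∈ openConn s y)} :=
  fun _ w o S W => goodStepCorner_fac_pocket w o S W

end

end Summit.CriticalPhenomena.PercolationContinuityZ3.Theorems
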